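import Literature.AlgebraicGeometry.Motives.HodgeLieSymplecticBlocksSemisimple
import Summits.HodgeConjecture.CorCM.MumfordTateRankTypeOneRelDimTwoBlocks
import HarnessLib

/-!
# Real multiplication of relative dimension TWO, II: `Lie Hg(H¹B) ⊗ ℂ` is a semisimple Lie algebra, and an ideal of it kills a real
# place or restricts onto its `𝔰𝔭₄` (Moonen–Zarhin 1999 §1 «no type IV ⟹ `Hg` semisimple», §3 (3.1))

COR-CM (cell `pub-hodgecm2`, seat `b27` gen 46, count-neutral Mumford–Tate-rank ladder; theorems only, no definition, no named fact;
UNCONDITIONAL — nothing here uses or asserts HC_CM).  Second CorCM file of the rung `t = 10e + 1` (type I(e), `m = 2`): for a complex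
abelian variety `B` whose endomorphism algebra is a TOTALLY REAL FIELD `E` with `dim B = 2[E:ℚ]`, the Literature theorems of
`Motives/HodgeLieSymplecticBlocksSemisimple` read on the blocks `V_τ` of `H¹(B) ⊗ ℂ` (`CorCM/MumfordTateRankTypeOneRelDimTwoBlocks`):

* **`isSemisimple_hodgeLieC_of_relDimTwo`** — every Lie subalgebra of `𝔤𝔩(H¹(B) ⊗ ℂ)` with carrier `Lie Hg(H¹B) ⊗ ℂ` is SEMISIMPLE
  (Mathlib `LieAlgebra.IsSemisimple ℂ`).
* **`restrict_ideal_dichotomy_of_relDimTwo`** — an ideal `N` of `Lie Hg(H¹B) ⊗ ℂ` either kills the block `V_τ` or restricts ONTO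
  `𝔰𝔭(V_τ, ψ_ℂ|_{V_τ})` («`𝔰𝔭₄` is simple»).

The Goursat assembly (`Lie Hg ⊗ ℂ = ⊕_τ 𝔰𝔭(V_τ)`, `t = 10e + 1`, Hodge = Lefschetz) is the sequel `CorCM/MumfordTateRankTypeOneRelDimTwo`.

## References
* [MoonenZarhin1999LowDim] B. Moonen, Yu. G. Zarhin, Math. Ann. 315 (1999), §1, §3 (3.1) and Lemma (3.4).
* [MoonenZarhin1995Duke] B. Moonen, Yu. G. Zarhin, Duke Math. J. 77 (1995) (Type I(2)).
* [Deligne1982HodgeCycles] P. Deligne, LNM 900 (1982), I §3 Prop. 3.6 («`Hg` is reductive»).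
* [Humphreys1972] J. E. Humphreys, GTM 9, §5.2.
-/

noncomputable section

open scoped TensorProduct
open CategoryTheory Module NumberField

namespace Summit.HodgeConjecture.CorCM

open Literature.AlgebraicGeometry.Motives
open Literature.AlgebraicGeometry.Motives.AbelianVariety
open Literature.AlgebraicGeometry.Motives.HodgeStructure
open Literature.AlgebraicGeometry.HodgeTheory
open Literature.AlgebraicGeometry.ComplexMultiplication

variable [HodgeTensorFacts.{0, 0}] {B : AbelianVariety ℂ} (hF : IsField B.endAlgebra)

omit [HodgeTensorFacts.{0, 0}] in
/-- A number field has positive degree. [folklore] -/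
private theorem finrank_pos_of_numberField₃ (E : Type*) [Field E] [NumberField E] : 0 < Module.finrank ℚ E :=
  Module.finrank_pos

omit [HodgeTensorFacts.{0, 0}] in
include hF in
/-- `0 < dim B` when `dim B = 2[End⁰B : ℚ]` and `End⁰B` is a field. [folklore] -/
private theorem dim_pos_of_relDimTwo (hdeg : B.dim = 2 * Module.finrank ℚ B.endAlgebra) : 0 < B.dim := by
  have h := finrank_pos_of_numberField₃ (EndField B hF)
  rw [EndField.finrank_eq hF] at h
  omega

/-- **`Lie Hg(H¹B) ⊗ ℂ` is a semisimple Lie algebra** for `End⁰B` a totally real field `E` with `dim B = 2[E:ℚ]` (type I(e), `m = 2`):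
every Lie subalgebra of `𝔤𝔩(H¹(B) ⊗ ℂ)` (commutator bracket) with carrier `Lie Hg(H¹B) ⊗ ℂ` satisfies Mathlib's
`LieAlgebra.IsSemisimple ℂ` —
`SymplecticBlocks.isSemisimple_of_eq_hodgeLieC` on the four-dimensional real blocks `V_τ`.  (Moonen–Zarhin §1: no factor of type IV
⟹ `Hg` semisimple; here over `ℂ`, with the radical computed by Deligne's reductivity.) [cite: MoonenZarhin1999LowDim, §1 and §3 (3.1)]
[cite: Deligne1982HodgeCycles, I §3 Prop. 3.6] [cite: Humphreys1972, §5.2] -/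
theorem isSemisimple_hodgeLieC_of_relDimTwo (hHD : exists_isReal_hodgeModel) (hI : hodgePQ_independent_of_hodgeModel)
    [IsTotallyReal (EndField B hF)] (hdeg : B.dim = 2 * Module.finrank ℚ B.endAlgebra) [Module.Finite ℚ (bettiCohomology B.X 1)] :
    letI : LieRing (Module.End ℂ (ℂ ⊗[ℚ] bettiCohomology B.X 1)) := LieRing.ofAssociativeRing
    ∀ 𝔏 : LieSubalgebra ℂ (Module.End ℂ (ℂ ⊗[ℚ] bettiCohomology B.X 1)),
      𝔏.toSubmodule = (BettiUniverse.hodge hHD (AbelianVariety.isSmoothProjective_holds (A := B)) 1).hodgeLieC →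
        LieAlgebra.IsSemisimple ℂ 𝔏 := by
  classical
  have hB0 : 0 < B.dim := dim_pos_of_relDimTwo hF hdeg
  have hX : IsSmoothProjective B.dim B.X := AbelianVariety.isSmoothProjective_holds
  obtain ⟨ψ⟩ := BettiUniverse.hodge_isPolarizable hHD (AbelianVariety.isSmoothProjective_holds (A := B)) 1
  exact SymplecticBlocks.isSemisimple_of_eq_hodgeLieC _ Nat.cast_one (BettiUniverse.hodge_isEffective hHD hX 1) ψ
    (isAdjointPair_self_of_isTotallyReal hF hHD hI hB0 ψ) (hodgeCharacter hF hHD hI) (hodgeCharacter_isReal hF hHD hI)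
    (isInternal_eigenBlock_hodgeCharacter hF hHD hI) (finrank_eigenBlock_hodgeCharacter_eq_four hF hHD hI hdeg)

/-- **An ideal of `Lie Hg(H¹B) ⊗ ℂ` kills the block `V_τ` or restricts ONTO `𝔰𝔭(V_τ, ψ_ℂ|_{V_τ})`** (type I(e), `m = 2`;
«`𝔰𝔭₄` is simple», `SymplecticBlocks.restrict_ideal_dichotomy`). [cite: MoonenZarhin1999LowDim, §3 (3.1) and Lemma (3.4)] [cite: Humphreys1972, §5.2] -/
theorem restrict_ideal_dichotomy_of_relDimTwo (hHD : exists_isReal_hodgeModel) (hI : hodgePQ_independent_of_hodgeModel)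
    [IsTotallyReal (EndField B hF)] (hdeg : B.dim = 2 * Module.finrank ℚ B.endAlgebra) [Module.Finite ℚ (bettiCohomology B.X 1)]
    (ψ : (BettiUniverse.hodge hHD (AbelianVariety.isSmoothProjective_holds (A := B)) 1).Polarization)
    (N : Submodule ℂ (Module.End ℂ (ℂ ⊗[ℚ] bettiCohomology B.X 1)))
    (hN : N ≤ (BettiUniverse.hodge hHD (AbelianVariety.isSmoothProjective_holds (A := B)) 1).hodgeLieC)
    (hNideal : ∀ W ∈ (BettiUniverse.hodge hHD (AbelianVariety.isSmoothProjective_holds (A := B)) 1).hodgeLieC, ∀ Y ∈ N,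
      W * Y - Y * W ∈ N) (τ : EndField B hF →+* ℂ) :
    (∀ Y ∈ N, ∀ x ∈ (BettiUniverse.hodge hHD (AbelianVariety.isSmoothProjective_holds (A := B)) 1).eigenBlock (hodgeCharacter hF hHD hI τ),
        Y x = 0) ∨
      ∀ g : Module.End ℂ ↥((BettiUniverse.hodge hHD (AbelianVariety.isSmoothProjective_holds (A := B)) 1).eigenBlock
          (hodgeCharacter hF hHD hI τ)),
        (∀ x y : (BettiUniverse.hodge hHD (AbelianVariety.isSmoothProjective_holds (A := B)) 1).eigenBlock (hodgeCharacter hF hHD hI τ),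
          ψ.form.baseChange ℂ ((g x : (BettiUniverse.hodge hHD (AbelianVariety.isSmoothProjective_holds (A := B)) 1).eigenBlock
              (hodgeCharacter hF hHD hI τ)) : ℂ ⊗[ℚ] bettiCohomology B.X 1) y +
            ψ.form.baseChange ℂ (x : ℂ ⊗[ℚ] bettiCohomology B.X 1) ((g y : (BettiUniverse.hodge hHD
              (AbelianVariety.isSmoothProjective_holds (A := B)) 1).eigenBlock (hodgeCharacter hF hHD hI τ)) :
                ℂ ⊗[ℚ] bettiCohomology B.X 1) = 0) →
        ∃ Y ∈ N, ∀ x : (BettiUniverse.hodge hHD (AbelianVariety.isSmoothProjective_holds (A := B)) 1).eigenBlock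
            (hodgeCharacter hF hHD hI τ),
          ((g x : (BettiUniverse.hodge hHD (AbelianVariety.isSmoothProjective_holds (A := B)) 1).eigenBlock (hodgeCharacter hF hHD hI τ)) :
            ℂ ⊗[ℚ] bettiCohomology B.X 1) = Y x := by
  classical
  have hB0 : 0 < B.dim := dim_pos_of_relDimTwo hF hdeg
  have hX : IsSmoothProjective B.dim B.X := AbelianVariety.isSmoothProjective_holds
  exact SymplecticBlocks.restrict_ideal_dichotomy _ Nat.cast_one (BettiUniverse.hodge_isEffective hHD hX 1) ψ
    (isAdjointPair_self_of_isTotallyReal hF hHD hI hB0 ψ) (hodgeCharacter hF hHD hI) (hodgeCharacter_isReal hF hHD hI)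
    (isInternal_eigenBlock_hodgeCharacter hF hHD hI) (finrank_eigenBlock_hodgeCharacter_eq_four hF hHD hI hdeg) N hN hNideal τ

end Summit.HodgeConjecture.CorCM

end
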